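import Literature.MathematicalPhysics.QuantumFieldTheory.Balaban1983to89.Beta.WindowIdentification

/-!
# `BalabanUV.Beta.D1BFx.ScaledWindowCount` — road «BF-x» for binder row D1, leaf A3.0: THE SCALED POWER-COUNTING LEMMA
# a weighted kernel whose window part is `≤ C·(r+1)^{p−4}·n^{−p}` on the shell `‖w‖∞ = r+1 ≤ n` (SOME `p ≥ 1`: «one power less singular than
# the marginal `|w|⁻⁴` after scaling») and whose tail beyond the block scale is the standard `E/(r+1)⁴·e^{−(δ/n)(r+1)}` has
# `|fullSum| ≤ 80·C + 80·E·(1 + 1/δ)` UNIFORMLY IN THE BLOCK SIZE `n` — whereas `p = 0` (the marginal case) is the `log n` of the MAIN term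

HONEST FRAMING (cell contract, verbatim): «discharging `BetaPertH` makes Bałaban's UV stability UNCONDITIONAL — a real constructive-QFT
result; it is NOT the continuum limit and NOT the Clay problem.»  This module is [folklore] finite combinatorics of `ℤ⁴` shells + one series
estimate, composed BY NAME from the tree (`TransferUV.card_annulus_succ_four_le`, `DyadicShell.sum_Ico_shellSum`, `WindowLog.shellSum`,
`WindowIdentification.psum/fullSum/abs_fullSum_sub_psum_le`).  It cites nothing, mints no `Prop`, discharges nothing of the wall; NOT summit
progress; NOT continuum, NOT Clay.

WHY (skeleton `HOME/beta/skeletons/D1-b2b-balaban-beta-d1-p2.md` v1.3 node A, leaf A3 «block-structured terms are O(1)»; referee R67 (c2): «A1/A3 are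
where the road lives or dies»).  The weighted one-shot kernel `K_n(w) = w_μw_ν·P_n(b, b+w)` of a term `τ` of the one-loop expansion has, in
bond/lattice units, the SCALING FORM `P_n(w) ≈ n^{−6}·𝒫^τ(w/n)` inside the block (`‖w‖ ≤ n`).  The MAIN term's germ is the massless bubble,
`𝒫 ∼ |ω|⁻⁶`, giving `|K_n(w)| ≲ ‖w‖⁻⁴` on the window — MARGINAL: `Σ_{r<n} 80(r+1)³·(r+1)⁻⁴ ∼ 80·log n` (the drift).  A REST term contains at
least one factor smooth at the block scale, so its germ is at least one power LESS singular, `𝒫^τ ∼ |ω|^{−6+p}`, `p ≥ 1`, i.e.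
`|K_n(w)| ≲ C·(r+1)^{p−4}·n^{−p}` on the shell `‖w‖∞ = r+1`: THIS module proves that such a window bound plus the standard massive tail gives a
full lattice sum bounded UNIFORMLY in `n` (`80·C + 80·E·(1 + 1/δ)`).  So each A3 sub-leaf reduces to exhibiting its `p ≥ 1` and its constants —
the counting is done here once.  Nothing about Bałaban's kernels is asserted: `K` is an arbitrary function `Pt → ℝ`.

CONTENT (all [folklore]).
* `abs_shellSum_le_of_scaledWindow` — one shell: `|shellSum K r| ≤ 80·C/n` for `r + 1 ≤ n` (`#shell ≤ 80(r+1)³`, `(r+1)^{p−1} ≤ n^{p−1}`).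
* `abs_psum_le_of_scaledWindow` — the window: `|psum K (n−1)| ≤ 80·C` (at most `n` shells of size `≤ 80·C/n`).
* `abs_fullSum_le_of_scaledWindow` — window + tail: `|fullSum K| ≤ 80·C + 80·E·(1 + 1/δ)`, `n`-free.
-/

namespace Summit.QuantumFields.BalabanUV.Beta.D1BFx.ScaledWindowCount

open Finset
open scoped BigOperators
open Literature.Probability.LatticeModels (annulus)
open Literature.MathematicalPhysics.QuantumFieldTheory.Balaban1983to89
open Literature.MathematicalPhysics.QuantumFieldTheory.Balaban1983to89.Beta
open DyadicShell (Pt sum_Ico_shellSum)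
open WindowLog (shellSum)
open WindowIdentification (psum fullSum abs_fullSum_sub_psum_le)
open TransferUV (card_annulus_succ_four_le)

/-- [folklore] **ONE SHELL.**  If `|K w| ≤ C·(r+1)^{p−1} / ((r+1)³·n^p)` on the shell `‖w‖∞ = r+1` with `r + 1 ≤ n`, `1 ≤ p`, then
`|shellSum K r| ≤ 80·C/n` (`#shell ≤ 80(r+1)³`, `(r+1)^{p−1} ≤ n^{p−1}`). -/
theorem abs_shellSum_le_of_scaledWindow {K : Pt → ℝ} {n p : ℕ} (hn : 1 ≤ n) (hp : 1 ≤ p) {C : ℝ} (hC : 0 ≤ C) {r : ℕ} (hr : r + 1 ≤ n)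
    (hwin : ∀ w ∈ annulus 4 r (r + 1), |K w| ≤ C * ((r : ℝ) + 1) ^ (p - 1) / (((r : ℝ) + 1) ^ 3 * (n : ℝ) ^ p)) :
    |shellSum K r| ≤ 80 * C / (n : ℝ) := by
  have hr0 : (0 : ℝ) < (r : ℝ) + 1 := by positivity
  have hn0 : (0 : ℝ) < (n : ℝ) := by exact_mod_cast hn
  have hrn : (r : ℝ) + 1 ≤ (n : ℝ) := by exact_mod_cast hr
  rw [shellSum]
  calc |∑ w ∈ annulus 4 r (r + 1), K w| ≤ ∑ w ∈ annulus 4 r (r + 1), |K w| := Finset.abs_sum_le_sum_abs _ _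
    _ ≤ ∑ w ∈ annulus 4 r (r + 1), C * ((r : ℝ) + 1) ^ (p - 1) / (((r : ℝ) + 1) ^ 3 * (n : ℝ) ^ p) :=
        Finset.sum_le_sum fun w hw => hwin w hw
    _ = ((annulus 4 r (r + 1)).card : ℝ) * (C * ((r : ℝ) + 1) ^ (p - 1) / (((r : ℝ) + 1) ^ 3 * (n : ℝ) ^ p)) := by
        rw [Finset.sum_const, nsmul_eq_mul]
    _ ≤ 80 * ((r : ℝ) + 1) ^ 3 * (C * ((r : ℝ) + 1) ^ (p - 1) / (((r : ℝ) + 1) ^ 3 * (n : ℝ) ^ p)) :=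
        mul_le_mul_of_nonneg_right (card_annulus_succ_four_le r) (by positivity)
    _ = 80 * C * (((r : ℝ) + 1) ^ (p - 1) / (n : ℝ) ^ p) := by
        field_simp
    _ ≤ 80 * C * ((n : ℝ) ^ (p - 1) / (n : ℝ) ^ p) := by
        apply mul_le_mul_of_nonneg_left _ (by positivity)
        exact div_le_div_of_nonneg_right (pow_le_pow_left₀ hr0.le hrn _) (by positivity)
    _ = 80 * C / (n : ℝ) := by
        have hp' : p = (p - 1) + 1 := (Nat.sub_add_cancel hp).symm
        rw [hp', pow_succ, Nat.add_sub_cancel]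
        field_simp

/-- [folklore] **THE WINDOW.**  Under the scaled window bound on every shell `r + 1 ≤ n`: `|psum K (n − 1)| ≤ 80·C` — at most `n − 1 < n` shells,
each `≤ 80·C/n`.  (For `p = 0`, the marginal case, the same count gives `80·C·Σ_{r<n} 1/(r+1) ∼ log n`: the MAIN term's drift.) -/
theorem abs_psum_le_of_scaledWindow {K : Pt → ℝ} {n p : ℕ} (hn : 1 ≤ n) (hp : 1 ≤ p) {C : ℝ} (hC : 0 ≤ C)
    (hwin : ∀ r : ℕ, r + 1 ≤ n → ∀ w ∈ annulus 4 r (r + 1), |K w| ≤ C * ((r : ℝ) + 1) ^ (p - 1) / (((r : ℝ) + 1) ^ 3 * (n : ℝ) ^ p)) :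
    |psum K (n - 1)| ≤ 80 * C := by
  have hn0 : (0 : ℝ) < (n : ℝ) := by exact_mod_cast hn
  rw [psum, ← sum_Ico_shellSum K (Nat.zero_le (n - 1))]
  calc |∑ r ∈ Finset.Ico 0 (n - 1), shellSum K r| ≤ ∑ r ∈ Finset.Ico 0 (n - 1), |shellSum K r| := Finset.abs_sum_le_sum_abs _ _
    _ ≤ ∑ r ∈ Finset.Ico 0 (n - 1), 80 * C / (n : ℝ) := by
        refine Finset.sum_le_sum fun r hr => ?_
        have hr' : r + 1 ≤ n := by
          have := (Finset.mem_Ico.mp hr).2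
          omega
        exact abs_shellSum_le_of_scaledWindow hn hp hC hr' (hwin r hr')
    _ = ((n - 1 : ℕ) : ℝ) * (80 * C / (n : ℝ)) := by
        rw [Finset.sum_const, Nat.card_Ico, Nat.sub_zero, nsmul_eq_mul]
    _ ≤ (n : ℝ) * (80 * C / (n : ℝ)) := by
        apply mul_le_mul_of_nonneg_right _ (by positivity)
        exact_mod_cast Nat.sub_le n 1
    _ = 80 * C := by field_simp

/-- [folklore] **WINDOW + TAIL ⇒ A BLOCK-SIZE-UNIFORM FULL SUM.**  Scaled window bound (`p ≥ 1`) on the shells `r + 1 ≤ n` and the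
standard scale-`n` massive tail `|K w| ≤ E/(r+1)⁴·e^{−(δ/n)(r+1)}` from `r ≥ n − 1` on give `|fullSum K| ≤ 80·C + 80·E·(1 + 1/δ)` —
INDEPENDENT OF `n`.  (Tail by `WindowIdentification.abs_fullSum_sub_psum_le` at `M := n − 1`, `Lr := n`: `80E(1 + n/δ)/n ≤ 80E(1 + 1/δ)`.) -/
theorem abs_fullSum_le_of_scaledWindow {K : Pt → ℝ} {n p : ℕ} (hn : 1 ≤ n) (hp : 1 ≤ p) {C E δ : ℝ} (hC : 0 ≤ C) (hE : 0 ≤ E)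
    (hδ : 0 < δ)
    (hwin : ∀ r : ℕ, r + 1 ≤ n → ∀ w ∈ annulus 4 r (r + 1), |K w| ≤ C * ((r : ℝ) + 1) ^ (p - 1) / (((r : ℝ) + 1) ^ 3 * (n : ℝ) ^ p))
    (htail : ∀ r : ℕ, n - 1 ≤ r → ∀ w ∈ annulus 4 r (r + 1), |K w| ≤ E / ((r : ℝ) + 1) ^ 4 * Real.exp (-(δ / (n : ℝ)) * ((r : ℝ) + 1))) :
    |fullSum K| ≤ 80 * C + 80 * E * (1 + 1 / δ) := by
  have hn0 : (0 : ℝ) < (n : ℝ) := by exact_mod_cast hn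
  have hwindow := abs_psum_le_of_scaledWindow hn hp hC hwin
  have htail' := abs_fullSum_sub_psum_le (K := K) (M := n - 1) hE hδ hn0 htail le_rfl
  have hM : (((n - 1 : ℕ) : ℝ) + 1) = (n : ℝ) := by
    rw [Nat.cast_sub hn, Nat.cast_one]; ring
  rw [hM] at htail'
  have htail'' : |fullSum K - psum K (n - 1)| ≤ 80 * E * (1 + 1 / δ) := by
    refine htail'.trans ?_
    rw [div_le_iff₀ hn0]
    have h1 : (1 : ℝ) ≤ n := by exact_mod_cast hn
    have h2 : 80 * E ≤ 80 * E * (n : ℝ) := le_mul_of_one_le_right (by positivity) h1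
    have h3 : 80 * E * (1 + (n : ℝ) / δ) = 80 * E + 80 * E / δ * n := by ring
    have h4 : 80 * E * (1 + 1 / δ) * (n : ℝ) = 80 * E * n + 80 * E / δ * n := by ring
    rw [h3, h4]
    linarith
  calc |fullSum K| = |(fullSum K - psum K (n - 1)) + psum K (n - 1)| := by rw [sub_add_cancel]
    _ ≤ |fullSum K - psum K (n - 1)| + |psum K (n - 1)| := abs_add_le _ _
    _ ≤ 80 * E * (1 + 1 / δ) + 80 * C := add_le_add htail'' hwindow
    _ = 80 * C + 80 * E * (1 + 1 / δ) := by ring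

end Summit.QuantumFields.BalabanUV.Beta.D1BFx.ScaledWindowCount
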